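import Summits.AtomisticToContinuum.Crystallization.Theorems.FrustratedLawDichotomyStrainedPatchHomEntryLeafHTUKit

/-!
# `entryLeafOKHT4U`: the analytic-slab leaf with inner certificate sub-tree over the REDUCED LABEL UNIVERSE — the fused two-fact certificate side
# (27623 `(H) HomFloor (1/625)`, hcp half; critic rows 1185 (iii) / 1187 «cert-cost lever: fused checker, measured»)

decomp-a2c hand-1 g32 (crux `AperiodicFrustratedLawGap`, stmt-AtomisticToContinuum-27623).  Verbatim `…HomEntryLeafHT4.entryLeafOKHT4` / `_sound` with the
label lists of `…HomEntryLeafHTUKit` (reduced universe `htUniv`, `1218` labels at the `0.9 t_b` crossover cell instead of `12167`) and the all-naive far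
slope chunks:

* §1 the certificate side over the universe: slab constant `htTU` (straddler count `|htRU|`), PSD confinement certificates `htConfU` (`htN` at `htTU`),
  `htCertOKU` (adds the side condition `htK < SC` of the exclusion test), `htCertOKU_spec`, ★ `htConfU_sound`, `slabConst_le_htTU`;
* §2 ★ `htCertSideU p c w` (eight conjuncts: `xiBallOK`, `htROKU`, `htCertOKU`, `curvCheckLJM` on `htCenU/htNaiU`, `forceJacCheckN` on `htFar1U`, `htFar2U`,
  the guards `htNaiOK htNearU ∧ htNaiOKN htFar1U ∧ htNaiOKN htFar2U`, `htGs nearU + htGsN far₁U + htGsN far₂U ≤ Gs`), ★ `entryLeafOKHT4U inner p t c w :=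
  htCertSideU p c w && treeOK inner t c (htWr p c w)` and ★★★ `entryLeafOKHT4U_sound` — the hver conclusion for ANY sound inner verdict (proof =
  `entryLeafOKHT4_sound`; the straddler step `hR` first disposes of the labels outside the universe by `…HTUKit.seven_lt_norm_of_not_mem_htUniv`).
  KERNEL (hand-1 g32, `cX90 × wX` @ `2⁻¹²`): the certificate side evaluates as TWO facts in `51 s + 75 s` (was eight facts, `≈ 630 s`).

Kernel definitions + soundness; 0 sorry; standard axioms; no instances / notation / `#eval`.  `--supports stmt-AtomisticToContinuum-27623`.
-/

noncomputable section

namespace Summit.AtomisticToContinuum.Crystallization.Theorems.FrustratedLawDichotomyStrainedPatchHomEntryLeafHT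


open scoped BigOperators RealInnerProductSpace
open Literature.Analysis.ValidatedNumerics.Numerics
open Summit.AtomisticToContinuum.Crystallization.Theorems.ChargedEnergyGapNegative (E3)
open Summit.AtomisticToContinuum.Crystallization.Theorems.FrustratedLawDichotomySchurCut (effPot w₄₅ ω₄)
open Summit.AtomisticToContinuum.Crystallization.Theorems.FrustratedLawDichotomyAveragingRuleTightFree (TightNearCap BadNearCap)
open Summit.AtomisticToContinuum.Crystallization.Theorems.FrustratedLawDichotomyExemptAbsorption (ExemptNear)
open Summit.AtomisticToContinuum.Crystallization.Theorems.FrustratedLawDichotomyStrainedPatchHomSplit (ExRec latPt hexFrame hcpShift HomFloor)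
open Summit.AtomisticToContinuum.Crystallization.Theorems.FrustratedLawDichotomyStrainedPatchTaylorChord (segGd)
open Summit.AtomisticToContinuum.Crystallization.Theorems.FrustratedLawDichotomyStrainedPatchHomEntryGram (entryFI mem_entryFI)
open Summit.AtomisticToContinuum.Crystallization.Theorems.FrustratedLawDichotomyStrainedPatchHomEntryGramHcp (dot3 shufFI mem_dot3 mem_shufFI)
open Summit.AtomisticToContinuum.Crystallization.Theorems.FrustratedLawDichotomyStrainedPatchHomForceKit (vecB mem_vecB)
open Summit.AtomisticToContinuum.Crystallization.Theorems.FrustratedLawDichotomyStrainedPatchHomHertzKit (hertzTest quadForm_ge_of_hertzTest)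
open Summit.AtomisticToContinuum.Crystallization.Theorems.FrustratedLawDichotomyStrainedPatchHomCurvCentreKit (cenShuf cenShuf_apply)
open Summit.AtomisticToContinuum.Crystallization.Theorems.FrustratedLawDichotomyStrainedPatchHomCurvLeaf
  (nodup_filter_append toFinset_filter_append)
open Summit.AtomisticToContinuum.Crystallization.Theorems.FrustratedLawDichotomyStrainedPatchHomCurvLeafL2 (refW)
open Summit.AtomisticToContinuum.Crystallization.Theorems.FrustratedLawDichotomyStrainedPatchHomCurvLJ (isCenLJ curvCheckLJM)
open Summit.AtomisticToContinuum.Crystallization.Theorems.FrustratedLawDichotomyStrainedPatchHomForceJacN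
  (fjQ fjVec fjE fjX forceJacCheckN boxLabels11 boxLabels11_toFinset boxLabels11_nodup)
open Summit.AtomisticToContinuum.Crystallization.Theorems.FrustratedLawDichotomyStrainedPatchHomSlopeLJ (slopeLJLabelOK slopeCheckLJ forceLJ_ref_bound_of_check)
open Summit.AtomisticToContinuum.Crystallization.Theorems.FrustratedLawDichotomyStrainedPatchHomForceHcp (xiBallOK norm_le_quarter_of_xiBallOK)
open Summit.AtomisticToContinuum.Crystallization.Theorems.FrustratedLawDichotomyStrainedPatchHomCurvLeafHCC (entryLeafOKHCCX entryLeafOKHCCX_sound)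
open Summit.AtomisticToContinuum.Crystallization.Theorems.FrustratedLawDichotomyStrainedPatchHomSlabConfine (abs_apply_le_of_qcert)
open Summit.AtomisticToContinuum.Crystallization.Theorems.FrustratedLawDichotomyStrainedPatchHomSlabLeaf
  (jac_floorM_of_three_checks abs_coord_le_of_confined hver_of_slabParts)
open Summit.AtomisticToContinuum.Crystallization.Theorems.FrustratedLawDichotomyStrainedPatchHomPrunedPolar (homFloor_of_prunedBoxSums_selfAdjoint)
open Summit.AtomisticToContinuum.Crystallization.Theorems.FrustratedLawDichotomyStrainedPatchHomCertTree (CertTree treeOK)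
open Summit.AtomisticToContinuum.Crystallization.Theorems.FrustratedLawDichotomyStrainedPatchHomEntryGram (rootC rootW)
open Summit.AtomisticToContinuum.Crystallization.Theorems.FrustratedLawDichotomyStrainedPatchHomEntryGramHcp (rootCH rootWH)
open Summit.AtomisticToContinuum.Crystallization.Theorems.FrustratedLawDichotomyStrainedPatchHomEntryTable (muRec muRec_ok)
open Summit.AtomisticToContinuum.Crystallization.Theorems.FrustratedLawDichotomyStrainedPatchHomEntryTableP (entryLeafOK6RBKP)
open Summit.AtomisticToContinuum.Crystallization.Theorems.FrustratedLawDichotomyStrainedPatchHomEntryTreeCert (fccHalf_of_entryTree6RBKP)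
open Summit.AtomisticToContinuum.Crystallization.Theorems.FrustratedLawDichotomyStrainedPatchHomEntryFlipHcp (HcpDich hcpHalf_of_entryTreeShuf)
open Summit.AtomisticToContinuum.Crystallization.Theorems.FrustratedLawDichotomyStrainedPatchHomSlopeLJ (slopeGsLJ slopeCheckLJ_slopeGsLJ)
open Summit.AtomisticToContinuum.Crystallization.Theorems.FrustratedLawDichotomyStrainedPatchHomCurvLJ (naiveLJ)
open Summit.AtomisticToContinuum.Crystallization.Theorems.FrustratedLawDichotomyStrainedPatchHomCertTree (treeOK_sound)
open Summit.AtomisticToContinuum.Crystallization.Theorems.FrustratedLawDichotomyStrainedPatchHomEntryQuickHcp (entryLeafOKHQ entryLeafOKHQ_imp)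
open Summit.AtomisticToContinuum.Crystallization.Theorems.FrustratedLawDichotomyStrainedPatchHomLeafTableCheckHcpV (entryLeafOKHVK_sound)

/-! ## §1. The certificate side over the reduced universe -/

/-- The scaled slab constant with the straddler count of the universe: `(S₇♯(7) + Gs/SC + |htRU|·6⁻⁷)·SC`. -/
def htTU (p : HTCert) (c w : (Fin 3 × Fin 3) ⊕ Fin 3 → ℤ) : ℤ :=
  cdiv (8892 * (SC : ℤ)) 823543 + p.Gs + ((htRU c w).length : ℤ) * cdiv (SC : ℤ) 279936

/-- The PSD certificate of the coordinate-`k` confinement at the slab constant `htTU`. -/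
def htConfU (p : HTCert) (c w : (Fin 3 × Fin 3) ⊕ Fin 3 → ℤ) (k : Fin 3) : Bool :=
  hertzTest (fun i j => FI.ofScaled (htN p (htTU p c w) k i j)) (fun _ _ => 0) 0

/-- All scalar side conditions (incl. `htK < SC` of the universe exclusion test) and the three PSD certificates. -/
def htCertOKU (p : HTCert) (c w : (Fin 3 × Fin 3) ⊕ Fin 3 → ℤ) : Bool :=
  (decide (htK c w < (SC : ℤ)) && decide (0 < htTU p c w)) && (decide (0 < p.γS 0) && decide (0 < p.γS 1) && decide (0 < p.γS 2)) &&
    (decide (0 ≤ p.rS 0) && decide (0 ≤ p.rS 1) && decide (0 ≤ p.rS 2)) && (htConfU p c w 0 && htConfU p c w 1 && htConfU p c w 2)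

/-- Unpacking `htCertOKU`. [formal bookkeeping] -/
theorem htCertOKU_spec {p : HTCert} {c w : (Fin 3 × Fin 3) ⊕ Fin 3 → ℤ} (h : htCertOKU p c w = true) :
    htK c w < (SC : ℤ) ∧ 0 < htTU p c w ∧ (∀ k : Fin 3, 0 < p.γS k) ∧ (∀ k : Fin 3, 0 ≤ p.rS k) ∧ (∀ k : Fin 3, htConfU p c w k = true) := by
  simp only [htCertOKU, Bool.and_eq_true, decide_eq_true_eq] at h
  obtain ⟨⟨⟨⟨hK, ht⟩, ⟨hγ0, hγ1⟩, hγ2⟩, ⟨hr0, hr1⟩, hr2⟩, ⟨hc0, hc1⟩, hc2⟩ := h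
  refine ⟨hK, ht, fun k => ?_, fun k => ?_, fun k => ?_⟩ <;> fin_cases k <;> assumption


/-- ★ **SOUNDNESS OF THE CONFINEMENT CERTIFICATE**: `htConfU p c w k` gives the hypothesis of `…HomSlabConfine.abs_apply_le_of_qcert` for the Q-form
`Q(x) = (λ_T/SC)‖x‖² + Σ_ij (D_ij/SC) x_i x_j`, `t = htT/SC`, `γ = γS_k/SC`, `r = rS_k/SC`. [folklore] -/
theorem htConfU_sound {p : HTCert} {c w : (Fin 3 × Fin 3) ⊕ Fin 3 → ℤ} {k : Fin 3} (h : htConfU p c w k = true) (x : E3) :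
    (htTU p c w : ℝ) / SC * ‖x‖ ^ 2 + (htTU p c w : ℝ) / SC * ((p.γS k : ℝ) / SC) ^ 2 * (x k) ^ 2 ≤
      2 * ((p.γS k : ℝ) / SC) * ((p.rS k : ℝ) / SC) *
        ((p.lamT : ℝ) / SC * ‖x‖ ^ 2 + ∑ i : Fin 3, ∑ j : Fin 3, (p.D i j : ℝ) / SC * (x i * x j)) := by
  have hS : (0 : ℝ) < SC := by norm_num [SC]
  have key := quadForm_ge_of_hertzTest h (M := fun i j => (htN p (htTU p c w) k i j : ℝ) / SC) (P := fun _ _ => 0)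
    (fun i j => FI.mem_ofScaled _) (fun i j => by simp) (fun i => x i)
  simp only [Int.cast_zero, zero_div, zero_mul, add_zero] at key
  -- `0 ≤ Σ_ij N_ij x_i x_j`
  have key0 : 0 ≤ ∑ i : Fin 3, ∑ j : Fin 3, (htN p (htTU p c w) k i j : ℝ) * (x i * x j) := by
    have e : ∑ i : Fin 3, ∑ j : Fin 3, (htN p (htTU p c w) k i j : ℝ) / SC * (x i * x j) =
        (∑ i : Fin 3, ∑ j : Fin 3, (htN p (htTU p c w) k i j : ℝ) * (x i * x j)) / SC := by
      rw [Finset.sum_div]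
      refine Finset.sum_congr rfl fun i _ => ?_
      rw [Finset.sum_div]
      exact Finset.sum_congr rfl fun j _ => by ring
    rw [e] at key
    exact (div_nonneg_iff.1 key).elim (fun h => h.1) fun h => by linarith [h.2]
  rw [htN_form] at key0
  have hA : ‖x‖ ^ 2 = ∑ i : Fin 3, x i ^ 2 := by
    rw [EuclideanSpace.norm_sq_eq]
    exact Finset.sum_congr rfl fun i _ => by rw [Real.norm_eq_abs, sq_abs]
  have hB : ∑ i : Fin 3, ∑ j : Fin 3, (p.D i j : ℝ) / SC * (x i * x j) = (∑ i : Fin 3, ∑ j : Fin 3, (p.D i j : ℝ) * (x i * x j)) / SC := by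
    rw [Finset.sum_div]
    refine Finset.sum_congr rfl fun i _ => ?_
    rw [Finset.sum_div]
    exact Finset.sum_congr rfl fun j _ => by ring
  rw [hA, hB]
  set A : ℝ := ∑ i : Fin 3, x i ^ 2 with hAdef
  set B : ℝ := ∑ i : Fin 3, ∑ j : Fin 3, (p.D i j : ℝ) * (x i * x j) with hBdef
  rw [← sub_nonneg]
  have e : 2 * ((p.γS k : ℝ) / SC) * ((p.rS k : ℝ) / SC) * ((p.lamT : ℝ) / SC * A + B / SC) -
      ((htTU p c w : ℝ) / SC * A + (htTU p c w : ℝ) / SC * ((p.γS k : ℝ) / SC) ^ 2 * (x k) ^ 2) =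
      (2 * (p.γS k : ℝ) * (p.rS k) * ((p.lamT : ℝ) * A + B) - (htTU p c w : ℝ) * SC * SC * A - (htTU p c w : ℝ) * (p.γS k) ^ 2 * (x k) ^ 2) / SC ^ 3 := by
    field_simp
    ring
  rw [e]
  positivity


/-- ★ The slab constant is dominated by `htT/SC`: `S₇♯(7) + Gs/SC + |R|·6⁻⁷ ≤ htT/SC` (`S₇♯(7) = 8892/7⁷`). [arithmetic] -/
theorem slabConst_le_htTU (p : HTCert) (c w : (Fin 3 × Fin 3) ⊕ Fin 3 → ℤ) :
    (6000 / 343 * (7 : ℝ)⁻¹ ^ 4 + 2880 / 49 * (7 : ℝ)⁻¹ ^ 5 + 10 / 7 * (7 : ℝ)⁻¹ ^ 6 + 2 * (7 : ℝ)⁻¹ ^ 7) + (p.Gs : ℝ) / SC +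
      (((htRU c w).toFinset.card : ℕ) : ℝ) * (6 : ℝ)⁻¹ ^ 7 ≤ (htTU p c w : ℝ) / SC := by
  classical
  have hS : (0 : ℝ) < SC := by norm_num [SC]
  have h7 : (6000 / 343 * (7 : ℝ)⁻¹ ^ 4 + 2880 / 49 * (7 : ℝ)⁻¹ ^ 5 + 10 / 7 * (7 : ℝ)⁻¹ ^ 6 + 2 * (7 : ℝ)⁻¹ ^ 7) = 8892 / 823543 := by
    norm_num
  have h1 : (8892 : ℝ) / 823543 ≤ ((cdiv (8892 * (SC : ℤ)) 823543 : ℤ) : ℝ) / SC := by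
    rw [le_div_iff₀ hS]
    have := div_le_cdiv (a := 8892 * (SC : ℤ)) (b := 823543) (by norm_num)
    push_cast at this
    linarith [show (8892 : ℝ) / 823543 * SC = 8892 * SC / 823543 by ring]
  have h2 : (6 : ℝ)⁻¹ ^ 7 ≤ ((cdiv (SC : ℤ) 279936 : ℤ) : ℝ) / SC := by
    rw [le_div_iff₀ hS]
    have := div_le_cdiv (a := (SC : ℤ)) (b := 279936) (by norm_num)
    have e : (6 : ℝ)⁻¹ ^ 7 * SC = (SC : ℝ) / 279936 := by norm_num; ring
    rw [e]
    push_cast at this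
    exact this
  have hcard : (((htRU c w).toFinset.card : ℕ) : ℝ) ≤ ((htRU c w).length : ℝ) := by exact_mod_cast List.toFinset_card_le (htRU c w)
  have h6 : (0 : ℝ) ≤ 6⁻¹ ^ 7 := by positivity
  have hc0 : (0 : ℝ) ≤ ((cdiv (SC : ℤ) 279936 : ℤ) : ℝ) / SC := h6.trans h2
  rw [h7]
  have e : (htTU p c w : ℝ) / SC = ((cdiv (8892 * (SC : ℤ)) 823543 : ℤ) : ℝ) / SC + (p.Gs : ℝ) / SC +
      ((htRU c w).length : ℝ) * (((cdiv (SC : ℤ) 279936 : ℤ) : ℝ) / SC) := by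
    simp only [htTU, Int.cast_add, Int.cast_mul, Int.cast_natCast]
    ring
  rw [e]
  have h3 : (((htRU c w).toFinset.card : ℕ) : ℝ) * (6 : ℝ)⁻¹ ^ 7 ≤ ((htRU c w).length : ℝ) * (((cdiv (SC : ℤ) 279936 : ℤ) : ℝ) / SC) :=
    mul_le_mul hcard h2 h6 (Nat.cast_nonneg _)
  linarith


/-! ## §2. ★ The fused certificate side, the leaf, ★★★ soundness -/

/-- ★ **THE FUSED CERTIFICATE SIDE** over the reduced universe (kernel: two facts — `htROKU ∧ htCertOKU ∧ far` and `curv ∧ near slope`). -/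
def htCertSideU (p : HTCert) (c w : (Fin 3 × Fin 3) ⊕ Fin 3 → ℤ) : Bool :=
  xiBallOK c w && htROKU c w && htCertOKU p c w &&
    curvCheckLJM c w (htCenU c w) (htNaiU c w) p.D p.lam₁ && forceJacCheckN c w (htFar1U c w) p.lam₂ && forceJacCheckN c w (htFar2U c w) p.lam₃ &&
    (htNaiOK c w (htNearU c w) && htNaiOKN c w (htFar1U c w) && htNaiOKN c w (htFar2U c w)) &&
    decide (htGs c w (htNearU c w) + htGsN c w (htFar1U c w) + htGsN c w (htFar2U c w) ≤ p.Gs)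

/-- ★ **THE ANALYTIC-SLAB LEAF OVER THE REDUCED UNIVERSE WITH AN INNER CERTIFICATE SUB-TREE.** -/
def entryLeafOKHT4U (inner : ((Fin 3 × Fin 3) ⊕ Fin 3 → ℤ) → ((Fin 3 × Fin 3) ⊕ Fin 3 → ℤ) → Bool) (p : HTCert) (t : CertTree ((Fin 3 × Fin 3) ⊕ Fin 3))
    (c w : (Fin 3 × Fin 3) ⊕ Fin 3 → ℤ) : Bool :=
  htCertSideU p c w && treeOK inner t c (htWr p c w)

/-- ★★★ **SOUNDNESS OF `entryLeafOKHT4U` IN THE hver SHAPE, FOR ANY SOUND INNER VERDICT.** [folklore chaining: `entryLeafOKHT3_sound` with the inner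
step through `…HomCertTree.treeOK_sound`] -/
theorem entryLeafOKHT4U_sound {μ : ℤ} {inner : ((Fin 3 × Fin 3) ⊕ Fin 3 → ℤ) → ((Fin 3 × Fin 3) ⊕ Fin 3 → ℤ) → Bool}
    (hinner : ∀ c w, inner c w = true → ∀ (U : E3 →L[ℝ] E3) (ξ : E3), (∀ v v' : E3, ⟪U v, v'⟫ = ⟪v, U v'⟫) → ‖U - 1‖ ≤ 1 / 4 →
      (∀ ab : Fin 3 × Fin 3, |(U (EuclideanSpace.single ab.2 (1 : ℝ))) ab.1 - (c (Sum.inl ab) : ℝ) / SC| ≤ (w (Sum.inl ab) : ℝ) / SC) →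
      (∀ i : Fin 3, |ξ i - (c (Sum.inr i) : ℝ) / SC| ≤ (w (Sum.inr i) : ℝ) / SC) → 0 ≤ ξ 0 → 0 ≤ ξ 2 →
      (∀ (M : ℕ) (z : Fin M → E3) (cc : Fin M), Function.Injective z →
          Set.range z = {x : E3 | dist x (z cc) ≤ 133 / 10 ∧ ∃ a : Fin 3 → ℤ,
            x = z cc + latPt U hexFrame a ∨ x = z cc + latPt U hexFrame a + U (hcpShift + ξ)} →
          TightNearCap (9 / 5) (3 / 2) z cc ∨ ExemptNear (9 / 5) ExRec z cc ∨ BadNearCap (9 / 5) (3 / 2) z cc) ∨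
        (μ : ℝ) / SC ≤ ∑ b ∈ (Fintype.piFinset fun _ : Fin 3 => Finset.Icc (-7 : ℤ) 7).filter (fun b => b ≠ 0), effPot w₄₅ ω₄ (3 / 400) ‖latPt U hexFrame b‖ +
          ∑ b ∈ (Fintype.piFinset fun _ : Fin 3 => Finset.Icc (-7 : ℤ) 7), effPot w₄₅ ω₄ (3 / 400) ‖latPt U hexFrame b + U (hcpShift + ξ)‖)
    {p : HTCert} {t : CertTree ((Fin 3 × Fin 3) ⊕ Fin 3)} {c w : (Fin 3 × Fin 3) ⊕ Fin 3 → ℤ} (h : entryLeafOKHT4U inner p t c w = true) (U : E3 →L[ℝ] E3) (ξ : E3)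
    (hsa : ∀ v v' : E3, ⟪U v, v'⟫ = ⟪v, U v'⟫) (hU : ‖U - 1‖ ≤ 1 / 4)
    (hbox : ∀ ab : Fin 3 × Fin 3, |(U (EuclideanSpace.single ab.2 (1 : ℝ))) ab.1 - (c (Sum.inl ab) : ℝ) / SC| ≤ (w (Sum.inl ab) : ℝ) / SC)
    (hξ : ∀ i : Fin 3, |ξ i - (c (Sum.inr i) : ℝ) / SC| ≤ (w (Sum.inr i) : ℝ) / SC) (h0 : 0 ≤ ξ 0) (h2 : 0 ≤ ξ 2) :
    (∀ (M : ℕ) (z : Fin M → E3) (cc : Fin M), Function.Injective z →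
        Set.range z = {x : E3 | dist x (z cc) ≤ 133 / 10 ∧ ∃ a : Fin 3 → ℤ,
          x = z cc + latPt U hexFrame a ∨ x = z cc + latPt U hexFrame a + U (hcpShift + ξ)} →
        TightNearCap (9 / 5) (3 / 2) z cc ∨ ExemptNear (9 / 5) ExRec z cc ∨ BadNearCap (9 / 5) (3 / 2) z cc) ∨
      (μ : ℝ) / SC ≤ ∑ b ∈ (Fintype.piFinset fun _ : Fin 3 => Finset.Icc (-7 : ℤ) 7).filter (fun b => b ≠ 0), effPot w₄₅ ω₄ (3 / 400) ‖latPt U hexFrame b‖ +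
        ∑ b ∈ (Fintype.piFinset fun _ : Fin 3 => Finset.Icc (-7 : ℤ) 7), effPot w₄₅ ω₄ (3 / 400) ‖latPt U hexFrame b + U (hcpShift + ξ)‖ := by
  classical
  have hS : (0 : ℝ) < SC := by norm_num [SC]
  unfold entryLeafOKHT4U htCertSideU at h
  simp only [Bool.and_eq_true, decide_eq_true_eq] at h
  obtain ⟨⟨⟨⟨⟨⟨⟨⟨hball, hROK⟩, hcert⟩, hcurvM⟩, hfar1⟩, hfar2⟩, ⟨⟨hs1, hs2⟩, hs3⟩⟩, hGs⟩, htree⟩ := h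
  obtain ⟨hKlt, hT, hγ, hr, hconf⟩ := htCertOKU_spec hcert
  -- the reference shuffle: the ξ-centre of the cell
  set ξ₀ : E3 := cenShuf c with hξ₀def
  have hw0 : ∀ i : Fin 3, (0 : ℝ) ≤ (w (Sum.inr i) : ℝ) / SC := fun i => (abs_nonneg _).trans (hξ i)
  have hξ₀box : ∀ i : Fin 3, |ξ₀ i - (c (Sum.inr i) : ℝ) / SC| ≤ (w (Sum.inr i) : ℝ) / SC := by
    intro i; rw [hξ₀def, cenShuf_apply, sub_self, abs_zero]; exact hw0 i
  have hn : ‖ξ‖ ≤ 1 / 4 := norm_le_quarter_of_xiBallOK hball hξ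
  have hn₀ : ‖ξ₀‖ ≤ 1 / 4 := norm_le_quarter_of_xiBallOK hball hξ₀box
  -- label finsets
  set B : Finset (Fin 3 → ℤ) := (htBU c w).toFinset with hBdef
  set R : Finset (Fin 3 → ℤ) := (htRU c w).toFinset with hRdef
  have hB : B ⊆ Fintype.piFinset fun _ : Fin 3 => Finset.Icc (-11 : ℤ) 11 := by
    intro b hb
    rw [← boxLabels11_toFinset]
    exact List.mem_toFinset.2 (mem_boxLabels11_of_mem_htUniv (mem_htUniv_of_mem_htBU (List.mem_toFinset.1 hb)))
  have hBin : ∀ bb ∈ B, ‖latPt U hexFrame bb + U (hcpShift + ξ)‖ ≤ 7 :=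
    fun bb hbb => norm_le_seven_of_htIn U hbox ξ hξ (htIn_of_mem_htBU (List.mem_toFinset.1 hbb))
  have hR : ∀ bb ∈ (Fintype.piFinset fun _ : Fin 3 => Finset.Icc (-11 : ℤ) 11) \ B, ‖latPt U hexFrame bb + U (hcpShift + ξ)‖ ≤ 7 →
      bb ∈ R ∧ 6 ≤ ‖latPt U hexFrame bb + U (hcpShift + ξ)‖ := by
    intro bb hbb h7
    obtain ⟨hbox11, hnotB⟩ := Finset.mem_sdiff.1 hbb
    rw [← boxLabels11_toFinset] at hbox11
    have hbL : bb ∈ boxLabels11 := List.mem_toFinset.1 hbox11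
    have hlo := lo_le_of_norm_le_seven U hbox ξ hξ h7
    by_cases huniv : bb ∈ htUniv c w
    swap
    · exact absurd h7 (not_le.2 (seven_lt_norm_of_not_mem_htUniv U hbox hξ hKlt hbL huniv))
    by_cases hin : htIn c w bb = true
    · exact absurd (List.mem_toFinset.2 (mem_htBU_of_htIn huniv hin)) hnotB
    · have hmemR : bb ∈ htRU c w := by
        refine List.mem_filter.2 ⟨huniv, ?_⟩
        simp only [Bool.and_eq_true, Bool.not_eq_true', decide_eq_true_eq]
        exact ⟨by simpa using hin, hlo⟩
      have h36 : 36 * (SC : ℤ) ≤ (fjQ c w bb).lo := by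
        have := List.all_eq_true.1 hROK bb hmemR
        simpa using this
      exact ⟨List.mem_toFinset.2 hmemR, six_le_norm_of_lo U hbox ξ hξ h36⟩
  -- the Q-floor along the segment
  have hcurv : ∀ s ∈ Set.Ioo (0 : ℝ) 1,
      ((p.lam₁ + p.lam₂ + p.lam₃ : ℤ) : ℝ) / SC * ‖U (ξ - ξ₀)‖ ^ 2 + ∑ i : Fin 3, ∑ j : Fin 3, (p.D i j : ℝ) / SC * ((U (ξ - ξ₀)) i * (U (ξ - ξ₀)) j) ≤
        ∑ bb ∈ B, segGd (fun x : ℝ => x⁻¹ ^ 7 - x⁻¹ ^ 13) (latPt U hexFrame bb + U (hcpShift + ξ₀)) (U (ξ - ξ₀)) s :=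
    fun s hs => jac_floorM_of_three_checks (htBU_nodup c w) hcurvM hfar1 hfar2 U hU hbox ξ₀ ξ hξ₀box hξ hn₀ hn hs
  -- the reference force bound, chunked
  have hf₀ : |∑ bb ∈ B, (‖latPt U hexFrame bb + U (hcpShift + ξ₀)‖⁻¹ ^ 8 - ‖latPt U hexFrame bb + U (hcpShift + ξ₀)‖⁻¹ ^ 14) *
      ⟪latPt U hexFrame bb + U (hcpShift + ξ₀), U (ξ - ξ₀)⟫| ≤ (p.Gs : ℝ) / SC * ‖U (ξ - ξ₀)‖ := by
    have key := refForce_htBU_le hs1 hs2 hs3 U hU hbox hn₀ ξ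
    refine key.trans (mul_le_mul_of_nonneg_right ?_ (norm_nonneg _))
    rw [div_le_div_iff_of_pos_right hS]
    exact_mod_cast hGs
  -- slab ⟹ confinement ⟹ the inner verdict on the confined box
  have hslab : ((p.lam₁ + p.lam₂ + p.lam₃ : ℤ) : ℝ) / SC * ‖U (ξ - ξ₀)‖ ^ 2 +
        ∑ i : Fin 3, ∑ j : Fin 3, (p.D i j : ℝ) / SC * ((U (ξ - ξ₀)) i * (U (ξ - ξ₀)) j) ≤
      ((6000 / 343 * (7 : ℝ)⁻¹ ^ 4 + 2880 / 49 * (7 : ℝ)⁻¹ ^ 5 + 10 / 7 * (7 : ℝ)⁻¹ ^ 6 + 2 * (7 : ℝ)⁻¹ ^ 7) + (p.Gs : ℝ) / SC +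
        R.card * (6 : ℝ)⁻¹ ^ 7) * ‖U (ξ - ξ₀)‖ →
      (∀ (M : ℕ) (z : Fin M → E3) (cc : Fin M), Function.Injective z →
          Set.range z = {x : E3 | dist x (z cc) ≤ 133 / 10 ∧ ∃ a : Fin 3 → ℤ,
            x = z cc + latPt U hexFrame a ∨ x = z cc + latPt U hexFrame a + U (hcpShift + ξ)} →
          TightNearCap (9 / 5) (3 / 2) z cc ∨ ExemptNear (9 / 5) ExRec z cc ∨ BadNearCap (9 / 5) (3 / 2) z cc) ∨
        (μ : ℝ) / SC ≤ ∑ b ∈ (Fintype.piFinset fun _ : Fin 3 => Finset.Icc (-7 : ℤ) 7).filter (fun b => b ≠ 0), effPot w₄₅ ω₄ (3 / 400) ‖latPt U hexFrame b‖ +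
          ∑ b ∈ (Fintype.piFinset fun _ : Fin 3 => Finset.Icc (-7 : ℤ) 7), effPot w₄₅ ω₄ (3 / 400) ‖latPt U hexFrame b + U (hcpShift + ξ)‖ := by
    intro hq
    have ht0 : (0 : ℝ) < (htTU p c w : ℝ) / SC := div_pos (by exact_mod_cast hT) hS
    have hle := slabConst_le_htTU p c w
    have hQ : (p.lamT : ℝ) / SC * ‖U (ξ - ξ₀)‖ ^ 2 + ∑ i : Fin 3, ∑ j : Fin 3, (p.D i j : ℝ) / SC * ((U (ξ - ξ₀)) i * (U (ξ - ξ₀)) j) ≤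
        (htTU p c w : ℝ) / SC * ‖U (ξ - ξ₀)‖ := by
      have e : (p.lamT : ℝ) = ((p.lam₁ + p.lam₂ + p.lam₃ : ℤ) : ℝ) := by simp [HTCert.lamT]
      rw [e]
      exact hq.trans (mul_le_mul_of_nonneg_right hle (norm_nonneg _))
    have hΔk : ∀ k : Fin 3, |(U (ξ - ξ₀)) k| ≤ (p.rS k : ℝ) / SC := fun k =>
      abs_apply_le_of_qcert (Q := fun x : E3 => (p.lamT : ℝ) / SC * ‖x‖ ^ 2 + ∑ i : Fin 3, ∑ j : Fin 3, (p.D i j : ℝ) / SC * (x i * x j))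
        ht0 (div_pos (by exact_mod_cast hγ k) hS) (div_nonneg (by exact_mod_cast hr k) hS.le) k (fun x => htConfU_sound (hconf k) x) hQ
    have hy := fun k => abs_coord_le_of_confined hU (ξ - ξ₀) (r := fun j => (p.rS j : ℝ) / SC) (κ := fun k => (htκ c w k : ℝ) / SC) hΔk
      (rowDev_le U hbox) k
    -- the confined box
    have hξ' : ∀ i : Fin 3, |ξ i - (c (Sum.inr i) : ℝ) / SC| ≤ (htW p c w (Sum.inr i) : ℝ) / SC := by
      intro i
      have hyi := hy i
      have e1 : (ξ - ξ₀) i = ξ i - (c (Sum.inr i) : ℝ) / SC := by rw [PiLp.sub_apply, hξ₀def, cenShuf_apply]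
      rw [e1] at hyi
      refine hyi.trans ?_
      rw [htW_inr]
      have hρ := sqrt_le_htρ p
      have hκ0 : (0 : ℝ) ≤ (htκ c w i : ℝ) / SC :=
        (Finset.sum_nonneg fun j _ => abs_nonneg _).trans (rowDev_le U hbox i)
      have hρ0 : (0 : ℝ) ≤ (htρ p : ℝ) := by
        have := (Real.sqrt_nonneg _).trans hρ
        rw [le_div_iff₀ hS, zero_mul] at this; exact this
      have hcd := div_le_cdiv (a := htκ c w i * 4 * htρ p) (b := 3 * (SC : ℤ)) (by norm_num [SC])
      have step : (htκ c w i : ℝ) / SC * (4 / 3 * Real.sqrt (∑ j : Fin 3, ((p.rS j : ℝ) / SC) ^ 2)) ≤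
          ((cdiv (htκ c w i * 4 * htρ p) (3 * SC) : ℤ) : ℝ) / SC := by
        have h1 : (htκ c w i : ℝ) / SC * (4 / 3 * Real.sqrt (∑ j : Fin 3, ((p.rS j : ℝ) / SC) ^ 2)) ≤
            (htκ c w i : ℝ) / SC * (4 / 3 * ((htρ p : ℝ) / SC)) := by gcongr
        refine h1.trans ?_
        rw [le_div_iff₀ hS]
        have e : (htκ c w i : ℝ) / SC * (4 / 3 * ((htρ p : ℝ) / SC)) * SC = ((htκ c w i * 4 * htρ p : ℤ) : ℝ) / ((3 * (SC : ℤ) : ℤ) : ℝ) := by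
          push_cast; field_simp
        rw [e]; exact hcd
      push_cast
      rw [add_div]
      linarith
    -- the point `(U_ab, ξ_i)` lies in the rounded confined box; run the inner certificate tree there
    have hx : ∀ k, |(Sum.elim (fun ab : Fin 3 × Fin 3 => (U (EuclideanSpace.single ab.2 (1 : ℝ))) ab.1) (fun i : Fin 3 => ξ i) k) -
        (c k : ℝ) / SC| ≤ (htWr p c w k : ℝ) / SC := by
      intro k
      rcases k with ab | i
      · exact hbox ab
      · refine (hξ' i).trans ?_
        rw [div_le_div_iff_of_pos_right hS]
        exact_mod_cast htW_le_htWr p c w i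
    have key := treeOK_sound SC_pos
      (P := fun x : (Fin 3 × Fin 3) ⊕ Fin 3 → ℝ => ∀ (V : E3 →L[ℝ] E3) (η : E3), (∀ v v' : E3, ⟪V v, v'⟫ = ⟪v, V v'⟫) → ‖V - 1‖ ≤ 1 / 4 →
        (∀ ab : Fin 3 × Fin 3, (V (EuclideanSpace.single ab.2 (1 : ℝ))) ab.1 = x (Sum.inl ab)) → (∀ i : Fin 3, η i = x (Sum.inr i)) → 0 ≤ η 0 → 0 ≤ η 2 →
        (∀ (M : ℕ) (z : Fin M → E3) (cc : Fin M), Function.Injective z →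
            Set.range z = {x : E3 | dist x (z cc) ≤ 133 / 10 ∧ ∃ a : Fin 3 → ℤ,
              x = z cc + latPt V hexFrame a ∨ x = z cc + latPt V hexFrame a + V (hcpShift + η)} →
            TightNearCap (9 / 5) (3 / 2) z cc ∨ ExemptNear (9 / 5) ExRec z cc ∨ BadNearCap (9 / 5) (3 / 2) z cc) ∨
          (μ : ℝ) / SC ≤ ∑ b ∈ (Fintype.piFinset fun _ : Fin 3 => Finset.Icc (-7 : ℤ) 7).filter (fun b => b ≠ 0), effPot w₄₅ ω₄ (3 / 400) ‖latPt V hexFrame b‖ +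
            ∑ b ∈ (Fintype.piFinset fun _ : Fin 3 => Finset.Icc (-7 : ℤ) 7), effPot w₄₅ ω₄ (3 / 400) ‖latPt V hexFrame b + V (hcpShift + η)‖)
      inner (fun c' w' hv x hx' V η hVsa hV1 hVx hηx h0' h2' =>
        hinner c' w' hv V η hVsa hV1 (fun ab => by rw [hVx ab]; exact hx' (Sum.inl ab)) (fun i => by rw [hηx i]; exact hx' (Sum.inr i)) h0' h2')
      t c (htWr p c w) htree _ hx U ξ hsa hU (fun _ => rfl) (fun _ => rfl) h0 h2
    exact key
  exact hver_of_slabParts hU hn₀ hn B R hB hBin hR hcurv hf₀ hslab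



end Summit.AtomisticToContinuum.Crystallization.Theorems.FrustratedLawDichotomyStrainedPatchHomEntryLeafHT

end
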